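import Mathlib
import HarnessLib
import Summits.RiemannHypothesis.RiemannHypothesis.Theses.NbSectionTwoDyadic
import Summits.RiemannHypothesis.RiemannHypothesis.Theorems.NbSectionTwoDyadicExpansion

/-!
# RiemannHypothesis / NbSectionTwoDyadic — ASSEMBLY closer

Route `NbSectionTwoDyadic`, item `Assembly` (stmt-RiemannHypothesis-22784):
`PoissonKernelFourier → DyadicPrimalResidual → DyadicDualCertificate → SectionTwoDyadicLaw`.
All the mathematics (expansion of the NB integral into the weighted step-function least-squares
form, weak duality, attainment, `lintegral = ofReal ∫`) is in the route-independent module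
`Theorems/NbSectionTwoDyadicExpansion.lean`; this file only instantiates it at `N = 2^K`,
`L = 2^(K+1)`, `D = 18·2^K − 8` with the two discrete cruxes as the certificate / primal data.
The hypothesis `PoissonKernelFourier` is consumed through its complex form (pairing file).

RH-free; exact law of a toy, 0 summit credit. No summit is proved by this file; nothing here bears
on the truth of RH.
-/

noncomputable section

-- D-0017: `Summit.<S>.<S>.…` is the designed namespace of a single-problem summit.
set_option linter.dupNamespace false

open scoped Real ComplexConjugate
open MeasureTheory Complex Filter Finset
open Literature.Barriers.RiemannHypothesis (zetaPartialSum)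

namespace Summit.RiemannHypothesis.RiemannHypothesis.Theorems.NbSectionTwo

/-! ## 4. The Assembly -/

/-- **Assembly** (item stmt-RiemannHypothesis-22784) of route `NbSectionTwoDyadic`:
`PoissonKernelFourier → DyadicPrimalResidual → DyadicDualCertificate → SectionTwoDyadicLaw`
(expansion of the NB integral into the weighted step-function least-squares form, weak duality,
attainment). RH-free; the exact law of a toy; no summit is proved by this. -/
theorem Assembly_proof :
    Summit.RiemannHypothesis.RiemannHypothesis.Theses.NbSectionTwoDyadic.Assembly := by
  unfold Summit.RiemannHypothesis.RiemannHypothesis.Theses.NbSectionTwoDyadic.Assembly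
    Summit.RiemannHypothesis.RiemannHypothesis.Theses.NbSectionTwoDyadic.SectionTwoDyadicLaw
    Summit.RiemannHypothesis.RiemannHypothesis.Theses.NbSectionTwoDyadic.DyadicPrimalResidual
    Summit.RiemannHypothesis.RiemannHypothesis.Theses.NbSectionTwoDyadic.DyadicDualCertificate
  intro _h9 h3 h2 K
  obtain ⟨horth, hinner, hnorm⟩ := h2 K
  obtain ⟨hres, htail⟩ := h3 K
  have hN : 1 ≤ 2 ^ K := Nat.one_le_two_pow
  have hD : (0 : ℝ) < 18 * 2 ^ K - 8 := by
    have : (1 : ℝ) ≤ 2 ^ K := one_le_pow₀ (by norm_num)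
    linarith
  have hL : 2 ^ (K + 1) = 2 * 2 ^ K := pow_succ' 2 K
  -- lintegral = ofReal integral, integral = 2π V(a)
  have hval : ∀ a : Fin (2 ^ K) → ℂ,
      ∫⁻ t : ℝ, ENNReal.ofReal (‖1 - zetaPartialSum 2 (1 / 2 + t * I) *
          ∑ n : Fin (2 ^ K), a n * ((n : ℂ) + 1) ^ (-(1 / 2 + t * I))‖ ^ 2 / (1 / 4 + t ^ 2))
        = ENNReal.ofReal (2 * π * ((∑ k ∈ Ico (1 : ℕ) (2 ^ (K + 1)),
            ‖1 - ∑ n : Fin (2 ^ K), a n * ((min 2 (k / ((n : ℕ) + 1)) : ℕ) : ℂ)‖ ^ 2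
              / ((k : ℝ) * (k + 1)))
          + ‖1 - ∑ n : Fin (2 ^ K), a n * ((min 2 (2 ^ (K + 1) / ((n : ℕ) + 1)) : ℕ) : ℂ)‖ ^ 2
            / ((2 ^ (K + 1) : ℕ) : ℝ))) := by
    intro a
    rw [← ofReal_integral_eq_lintegral_ofReal (sectionTwo_integrable (2 ^ K) hN a)
      (Eventually.of_forall fun t => by positivity), sectionTwo_integral_eq (2 ^ K) hN a, hL]
  -- the certificate in the generic vocabulary (`L = 2^(K+1)`, tail weight `1/L`)
  have horth' : ∀ j : ℕ, 1 ≤ j → j ≤ 2 ^ K → (∑ k ∈ Finset.Ico j (2 ^ (K + 1)),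
      1 / ((k : ℝ) * (k + 1)) * (4 * (-2 : ℝ) ^ Nat.log 2 k / (18 * 2 ^ K - 8)) *
        ((min 2 (k / j) : ℕ) : ℝ))
      + (-1 : ℝ) ^ (K + 1) * 2 ^ (K + 1) / (18 * 2 ^ K - 8) * 2 / ((2 ^ (K + 1) : ℕ) : ℝ)
      = 0 := by
    intro j hj1 hj2
    rw [← horth j hj1 hj2]
    push_cast
    ring
  have hinner' : (∑ k ∈ Finset.Ico (1 : ℕ) (2 ^ (K + 1)), 1 / ((k : ℝ) * (k + 1)) *
      (4 * (-2 : ℝ) ^ Nat.log 2 k / (18 * 2 ^ K - 8)))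
      + (-1 : ℝ) ^ (K + 1) * 2 ^ (K + 1) / (18 * 2 ^ K - 8) / ((2 ^ (K + 1) : ℕ) : ℝ)
      = 1 / (18 * 2 ^ K - 8) := by
    rw [← hinner]
    push_cast
    ring
  have hnorm' : (∑ k ∈ Finset.Ico (1 : ℕ) (2 ^ (K + 1)), 1 / ((k : ℝ) * (k + 1)) *
      (4 * (-2 : ℝ) ^ Nat.log 2 k / (18 * 2 ^ K - 8)) ^ 2)
      + ((-1 : ℝ) ^ (K + 1) * 2 ^ (K + 1) / (18 * 2 ^ K - 8)) ^ 2 / ((2 ^ (K + 1) : ℕ) : ℝ)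
      = 1 / (18 * 2 ^ K - 8) := by
    rw [← hnorm]
    push_cast
    ring
  refine ⟨⟨fun n => ∑ i ∈ Finset.range (K + 1), if (n : ℕ) + 1 = 2 ^ i then
      (((-1 : ℝ) ^ i * (6 * (3 * 2 ^ K - 2 ^ (i + 1))) / (18 * 2 ^ K - 8) : ℝ) : ℂ) else 0, ?_⟩,
    fun a => ?_⟩
  · -- attainment at the dyadic primal vector
    rw [hval, stepForm_attained K
        (fun i => (-1 : ℝ) ^ i * (6 * (3 * 2 ^ K - 2 ^ (i + 1))) / (18 * 2 ^ K - 8))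
        (fun k => 4 * (-2 : ℝ) ^ Nat.log 2 k / (18 * 2 ^ K - 8))
        ((-1 : ℝ) ^ (K + 1) * 2 ^ (K + 1) / (18 * 2 ^ K - 8)) (1 / (18 * 2 ^ K - 8))
        hres htail hnorm _ (fun n => rfl)]
    congr 1
    ring
  · -- weak duality for an arbitrary complex mollifier
    rw [hval, stepForm_lower_bound (2 ^ K) (2 ^ (K + 1)) hL
      (fun k => 4 * (-2 : ℝ) ^ Nat.log 2 k / (18 * 2 ^ K - 8))
      ((-1 : ℝ) ^ (K + 1) * 2 ^ (K + 1) / (18 * 2 ^ K - 8)) (1 / (18 * 2 ^ K - 8))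
      horth' hinner' hnorm' a]
    refine ENNReal.ofReal_le_ofReal ?_
    have hS : 0 ≤ (∑ k ∈ Ico (1 : ℕ) (2 ^ (K + 1)), 1 / ((k : ℝ) * (k + 1)) *
        ‖(1 - ∑ n : Fin (2 ^ K), a n * ((min 2 (k / ((n : ℕ) + 1)) : ℕ) : ℂ)) -
          ((4 * (-2 : ℝ) ^ Nat.log 2 k / (18 * 2 ^ K - 8) : ℝ) : ℂ)‖ ^ 2)
      + 1 / ((2 ^ (K + 1) : ℕ) : ℝ) *
        ‖(1 - ∑ n : Fin (2 ^ K), a n * ((min 2 (2 ^ (K + 1) / ((n : ℕ) + 1)) : ℕ) : ℂ)) -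
          (((-1 : ℝ) ^ (K + 1) * 2 ^ (K + 1) / (18 * 2 ^ K - 8) : ℝ) : ℂ)‖ ^ 2 := by
      positivity
    have hπ : (0 : ℝ) ≤ 2 * π := by positivity
    have hdiv : 2 * π / (18 * 2 ^ K - 8) = 2 * π * (1 / (18 * 2 ^ K - 8)) := by ring
    rw [hdiv, mul_add]
    linarith [mul_nonneg hπ hS]

end Summit.RiemannHypothesis.RiemannHypothesis.Theorems.NbSectionTwo

end
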